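import Summits.QuantumFields.YangMills.Theorems.ColdStartUniversalityLatticeLangevinWilsonEntropyDecay
import HarnessLib

/-!
# Route `ColdStartUniversality` (fixed-cut-off package, entropy side): LOG-SOBOLEV ⇒ EXPONENTIAL DECAY OF ENTROPY for ALL
# bounded measurable initial densities — `Ent_μ(κ_t g) ≤ e^{−4ρt} Ent_μ(g)`

Helper file (seat `ym-line-csu-p1`, g21; `--supports stmt-QuantumFields-27363`), sequel of `…WilsonEntropyDecay`.  SU(2) SZZ dynamics at
`(L, β')`, Wilson measure `μ = μ_{β'}`, ANY realising kernel family `κ`, `Ent_μ(w) = ∫ w log w dμ − (∫ w dμ) log(∫ w dμ)`: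

* `exists_cylinder_uniform_near` — every continuous `G` is uniformly within `ε` of a `C³` compactly supported cylinder `f∘coords`
  (ridge density + uniform strong continuity of the `β' = 0` semigroup);
* `exists_pos_cylinder_integral_abs_sub_le` — a measurable `0 ≤ g ≤ M` is within `ε` in `L¹(μ)` of a POSITIVE `C³` compactly
  supported cylinder `F` with `0 < F ≤ M + 2` (density of `C(X)` in `L¹(μ)`, clamping, the previous lemma);
* `integral_abs_transition_sub_le` — `∫ |κ_t a − κ_t b| dμ ≤ ∫ |a − b| dμ` (bounded measurable `a, b`; invariance of `μ`);
* ★★ `entropy_transition_le_exp_of_generatorLogSobolev_of_measurable` — under the generator-form log-Sobolev inequality with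
  constant `ρ > 0`: `Ent_μ(κ_t g) ≤ e^{−4ρt} Ent_μ(g)` for every measurable `0 ≤ g ≤ M` and `t ≥ 0` — from the positive-cylinder case
  (`entropy_transition_le_exp_of_generatorLogSobolev`) by `L¹` approximation, the entropies passing to the limit by
  `EntropyFlow.tendsto_integral_comp_of_tendsto_integral_abs_sub` (uniform bounds, `x log x` continuous).

By reversibility, for a probability density `g` the measure `(κ_t g)·μ` is the law at time `t` of the dynamics started from `g·μ`:
this is `KL(law_t ‖ μ_{β'}) ≤ e^{−4ρt} KL(law_0 ‖ μ_{β'})` — the cold-start reading in PHYSICAL time is the sequel.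
THEOREMS ONLY, no definition, no sorry.  HONEST FRAMING: RECORD-rung R3 plumbing at FIXED cut-off; the log-Sobolev inequality is the
HYPOTHESIS; nothing K-uniform is proved; no crux, rung or summit statement is proved; the Yang–Mills mass gap is NOT proved.
-/

set_option autoImplicit false

noncomputable section

namespace Summit.QuantumFields.YangMills.Theorems.ColdStartUniversality

open MeasureTheory ProbabilityTheory Filter Set Topology
open scoped BigOperators NNReal ENNReal
open Literature.Probability.Process Literature.MathematicalPhysics.QuantumFieldTheory
open Literature.MathematicalPhysics.QuantumLattice (fundamentalRep fundamentalLatticeRep continuous_fundamentalRep)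

variable {L : ℕ} [NeZero L]

/-! ## §1. Approximation by positive smooth cylinders -/

/-- **`C³` cylinders are uniformly dense in `C(SU(2)^E)`**: for continuous `G` and `ε > 0` there is a `C³` compactly supported `f`
with `|G(x) − f(coords x)| ≤ ε` for all `x` (`f∘coords = κ⁰_s R`, `R` a ridge function `ε/2`-close to `G`, `s` small). [folklore] -/
theorem exists_cylinder_uniform_near (L : ℕ) [NeZero L]
    {G : GaugeConfig 3 L (Matrix.specialUnitaryGroup (Fin 2) ℂ) → ℝ} (hG : Continuous G) {ε : ℝ} (hε : 0 < ε) :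
    ∃ f : (Edge 3 L × Fin 2 × Fin 2 × Bool → ℝ) → ℝ, ContDiff ℝ 3 f ∧ HasCompactSupport f ∧
      let coords : GaugeConfig 3 L (Matrix.specialUnitaryGroup (Fin 2) ℂ) → (Edge 3 L × Fin 2 × Fin 2 × Bool → ℝ) :=
        fun V q => (fun z : ℂ => if q.2.2.2 then z.im else z.re)
          ((fundamentalRep (Fin 2) (V q.1) : Matrix (Fin 2) (Fin 2) ℂ) q.2.1 q.2.2.1)
      ∀ x, |G x - f (coords x)| ≤ ε := by
  classical
  haveI := secondCountableTopology_su2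
  haveI := borelSpace_config L
  obtain ⟨κ₀, hκ₀M, -, hreal₀⟩ := exists_transitionKernel L 0
  haveI := hκ₀M
  have hjc : Continuous (Function.uncurry fun (t : ℝ≥0) (x : GaugeConfig 3 L (Matrix.specialUnitaryGroup (Fin 2) ℂ)) =>
      ∫ y, G y ∂(κ₀ t x)) := continuous_transitionKernel_action 0 κ₀ hreal₀ hG
  have hκ00 : κ₀ 0 = Kernel.id := transitionKernel_zero_eq_id L 0 κ₀ hreal₀
  have hev := eventually_forall_abs_sub_lt_of_continuous_uncurry hjc 0 (half_pos hε)
  obtain ⟨s₁, hs₁, hball⟩ := NNReal.nhds_zero_basis.eventually_iff.1 hev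
  set s : ℝ≥0 := s₁ / 2 with hsdef
  have hss₁ : s < s₁ := NNReal.half_lt_self hs₁.ne'
  obtain ⟨R, hRc, hRG, f, hf, hfc, hfeq⟩ := exists_ridge_near_and_cylinder_transition L κ₀ hreal₀ hG (half_pos hε) s
  refine ⟨f, hf, hfc, ?_⟩
  intro coords x
  have hfx : f (coords x) = ∫ y, R y ∂(κ₀ s x) := hfeq x
  rw [hfx]
  have h1 : |(∫ y, R y ∂(κ₀ s x)) - ∫ y, G y ∂(κ₀ s x)| ≤ ε / 2 :=
    abs_integral_sub_integral_le_of_abs_sub_le (μ := κ₀ s x) hRc hG fun y => (hRG y).le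
  have h2 : |(∫ y, G y ∂(κ₀ s x)) - G x| < ε / 2 := by
    have := hball (show s ∈ Iio s₁ from hss₁) x
    simpa only [hκ00, Kernel.id_apply, integral_dirac] using this
  rw [abs_sub_comm]
  calc |(∫ y, R y ∂(κ₀ s x)) - G x|
      = |((∫ y, R y ∂(κ₀ s x)) - ∫ y, G y ∂(κ₀ s x)) + ((∫ y, G y ∂(κ₀ s x)) - G x)| := by ring_nf
    _ ≤ |(∫ y, R y ∂(κ₀ s x)) - ∫ y, G y ∂(κ₀ s x)| + |(∫ y, G y ∂(κ₀ s x)) - G x| := abs_add_le _ _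
    _ ≤ ε := by linarith [h2.le]

/-- **Positive smooth cylinders are `L¹(μ_{β'})`-dense in the bounded non-negative measurable functions, with uniform bounds**:
for measurable `0 ≤ g ≤ M` and `ε > 0` there is a `C³` compactly supported cylinder `F = f∘coords` with `0 < F`, `F ≤ M + 2` and
`∫ |F − g| dμ_{β'} ≤ ε` (continuous `L¹` approximation, clamping to `[0, M]`, a uniform cylinder approximation of the clamp shifted
up by `ε'`). [folklore] -/
theorem exists_pos_cylinder_integral_abs_sub_le (L : ℕ) [NeZero L] (β' : ℝ)
    {g : GaugeConfig 3 L (Matrix.specialUnitaryGroup (Fin 2) ℂ) → ℝ} (hgm : Measurable g) {M : ℝ} (hg0 : ∀ x, 0 ≤ g x)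
    (hgM : ∀ x, g x ≤ M) {ε : ℝ} (hε : 0 < ε) :
    ∃ f : (Edge 3 L × Fin 2 × Fin 2 × Bool → ℝ) → ℝ, ContDiff ℝ 3 f ∧ HasCompactSupport f ∧
      let coords : GaugeConfig 3 L (Matrix.specialUnitaryGroup (Fin 2) ℂ) → (Edge 3 L × Fin 2 × Fin 2 × Bool → ℝ) :=
        fun V q => (fun z : ℂ => if q.2.2.2 then z.im else z.re)
          ((fundamentalRep (Fin 2) (V q.1) : Matrix (Fin 2) (Fin 2) ℂ) q.2.1 q.2.2.1)
      (∀ x, 0 < f (coords x)) ∧ (∀ x, f (coords x) ≤ M + 2) ∧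
        (∫ x, |f (coords x) - g x| ∂(wilsonMeasure (d := 3) (L := L) (fundamentalRep (Fin 2)) β')) ≤ ε := by
  classical
  haveI := secondCountableTopology_su2
  haveI := borelSpace_config L
  set μ : Measure (GaugeConfig 3 L (Matrix.specialUnitaryGroup (Fin 2) ℂ)) :=
    wilsonMeasure (d := 3) (L := L) (fundamentalRep (Fin 2)) β' with hμ
  haveI : IsProbabilityMeasure μ :=
    isProbabilityMeasure_wilsonMeasure (d := 3) (L := L) (fundamentalRep (Fin 2)) (continuous_fundamentalRep (Fin 2)) β'
  have hM0 : 0 ≤ M := (hg0 (Classical.arbitrary _)).trans (hgM _)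
  -- `ε' = min(ε/3, 1)`
  set ε' : ℝ := min (ε / 3) 1 with hε'
  have hε'0 : 0 < ε' := lt_min (by positivity) one_pos
  have hε'ε : ε' ≤ ε / 3 := min_le_left _ _
  have hε'1 : ε' ≤ 1 := min_le_right _ _
  -- (1) a continuous `L¹` approximation
  have hgi : Integrable g μ := Integrable.of_bound hgm.aestronglyMeasurable M
    (ae_of_all _ fun x => by rw [Real.norm_eq_abs, abs_of_nonneg (hg0 x)]; exact hgM x)
  obtain ⟨c, hc, -⟩ := hgi.exists_boundedContinuous_integral_sub_le hε'0
  -- (2) clamp to `[0, M]`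
  set c' : GaugeConfig 3 L (Matrix.specialUnitaryGroup (Fin 2) ℂ) → ℝ := fun x => max 0 (min M (c x)) with hc'
  have hc'c : Continuous c' := continuous_const.max (continuous_const.min c.continuous)
  have hc'0 : ∀ x, 0 ≤ c' x := fun x => le_max_left _ _
  have hc'M : ∀ x, c' x ≤ M := fun x => max_le hM0 (min_le_left _ _)
  have hc'g : ∀ x, |c' x - g x| ≤ |c x - g x| := by
    intro x
    have h0 := hg0 x; have hM := hgM x
    simp only [hc']
    rcases le_total (c x) 0 with h1 | h1
    · rw [min_eq_right (h1.trans hM0), max_eq_left h1, zero_sub, abs_neg, abs_of_nonneg h0]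
      calc g x ≤ g x - c x := by linarith
        _ ≤ |c x - g x| := by rw [abs_sub_comm]; exact le_abs_self _
    · rcases le_total M (c x) with h2 | h2
      · rw [min_eq_left h2, max_eq_right hM0, abs_of_nonneg (by linarith : 0 ≤ M - g x)]
        calc M - g x ≤ c x - g x := by linarith
          _ ≤ |c x - g x| := le_abs_self _
      · rw [min_eq_right h2, max_eq_right h1]
  -- (3) a cylinder uniformly `ε'/2`-close to `c' + ε'`
  obtain ⟨f, hf, hfc, hfF⟩ := exists_cylinder_uniform_near L (hc'c.add continuous_const) (half_pos hε'0) (G := fun x => c' x + ε')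
  refine ⟨f, hf, hfc, ?_⟩
  intro coords
  set F : GaugeConfig 3 L (Matrix.specialUnitaryGroup (Fin 2) ℂ) → ℝ := fun x => f (coords x) with hFdef
  change (∀ x, 0 < F x) ∧ (∀ x, F x ≤ M + 2) ∧ (∫ x, |F x - g x| ∂μ) ≤ ε
  have hFx : ∀ x, |c' x + ε' - F x| ≤ ε' / 2 := fun x => hfF x
  have hFpos : ∀ x, 0 < F x := by
    intro x; have := hFx x; rw [abs_le] at this; linarith [hc'0 x, this.2]
  have hFM : ∀ x, F x ≤ M + 2 := by
    intro x; have := hFx x; rw [abs_le] at this; linarith [hc'M x, this.1]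
  refine ⟨hFpos, hFM, ?_⟩
  -- (4) `∫ |F − g| ≤ ∫ |c − g| + 3ε'/2 ≤ ε`
  have hFc : Continuous F := hf.continuous.comp (continuous_coords (L := L))
  have hci : Integrable (fun x => |c x - g x|) μ := ((c.continuous.integrable_of_hasCompactSupport
      (HasCompactSupport.of_compactSpace _)).sub hgi).abs
  have hpt : ∀ x, |F x - g x| ≤ |c x - g x| + 3 * ε' / 2 := by
    intro x
    have h1 := hFx x; have h2 := hc'g x
    calc |F x - g x| = |(F x - (c' x + ε')) + ε' + (c' x - g x)| := by ring_nf
      _ ≤ |(F x - (c' x + ε')) + ε'| + |c' x - g x| := abs_add_le _ _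
      _ ≤ (|F x - (c' x + ε')| + |ε'|) + |c' x - g x| := by gcongr; exact abs_add_le _ _
      _ ≤ ε' / 2 + ε' + |c x - g x| := by
          rw [abs_sub_comm, abs_of_pos hε'0]; gcongr
      _ = |c x - g x| + 3 * ε' / 2 := by ring
  have hFgi : Integrable (fun x => |F x - g x|) μ := ((integrable_of_continuous_of_compactSpace hFc μ).sub hgi).abs
  calc ∫ x, |F x - g x| ∂μ ≤ ∫ x, (|c x - g x| + 3 * ε' / 2) ∂μ := integral_mono hFgi (hci.add (integrable_const _)) hpt
    _ = (∫ x, |c x - g x| ∂μ) + 3 * ε' / 2 := by rw [integral_add hci (integrable_const _), integral_const, probReal_univ, one_smul]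
    _ ≤ ε' + 3 * ε' / 2 := by
        gcongr
        calc ∫ x, |c x - g x| ∂μ = ∫ x, ‖g x - c x‖ ∂μ := by
              refine integral_congr_ae (Eventually.of_forall fun x => ?_); simp only [Real.norm_eq_abs, abs_sub_comm]
          _ ≤ ε' := hc
    _ ≤ ε := by linarith

/-! ## §2. `κ_t` is an `L¹(μ)`-contraction on bounded measurable functions -/

/-- **`∫ |κ_t a − κ_t b| dμ_{β'} ≤ ∫ |a − b| dμ_{β'}`** for bounded measurable `a, b` (Jensen in `κ_t(x, ·)` and the invariance of
`μ_{β'}`, SZZ Lemma 3.3). [cite: ShenZhuZhu2022, §3 Lemma 3.3 (p. 13)] -/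
theorem integral_abs_transition_sub_le (L : ℕ) [NeZero L] (β' : ℝ)
    (κ : ℝ≥0 → Kernel (GaugeConfig 3 L (Matrix.specialUnitaryGroup (Fin 2) ℂ))
      (GaugeConfig 3 L (Matrix.specialUnitaryGroup (Fin 2) ℂ))) [∀ t, IsMarkovKernel (κ t)]
    (hreal : ∀ (t : ℝ≥0) (x : GaugeConfig 3 L (Matrix.specialUnitaryGroup (Fin 2) ℂ))
        (Ω : Type) [MeasurableSpace Ω] (P : Measure Ω) [IsProbabilityMeasure P]
        (W : ℝ≥0 → Ω → (Edge 3 L × NoiseIdx 2 → ℝ)) (hW : IsFlatBrownian W P)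
        (U : ℝ≥0 → Ω → GaugeConfig 3 L (Matrix.specialUnitaryGroup (Fin 2) ℂ)),
        (∀ ω, U 0 ω = x) →
        (latticeLangevinDynamics (fundamentalLatticeRep 2) β').IsSolution (fundamentalRep (Fin 2))
          hW.natFiltration P W U →
        κ t x = P.map (U t))
    (t : ℝ≥0) {a b : GaugeConfig 3 L (Matrix.specialUnitaryGroup (Fin 2) ℂ) → ℝ} (ham : Measurable a) (hbm : Measurable b)
    {M : ℝ} (ha : ∀ x, |a x| ≤ M) (hb : ∀ x, |b x| ≤ M) :
    ∫ x, |(∫ y, a y ∂(κ t x)) - ∫ y, b y ∂(κ t x)| ∂(wilsonMeasure (d := 3) (L := L) (fundamentalRep (Fin 2)) β') ≤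
      ∫ x, |a x - b x| ∂(wilsonMeasure (d := 3) (L := L) (fundamentalRep (Fin 2)) β') := by
  classical
  haveI := secondCountableTopology_su2
  haveI := borelSpace_config L
  set μ : Measure (GaugeConfig 3 L (Matrix.specialUnitaryGroup (Fin 2) ℂ)) :=
    wilsonMeasure (d := 3) (L := L) (fundamentalRep (Fin 2)) β' with hμ
  haveI : IsProbabilityMeasure μ :=
    isProbabilityMeasure_wilsonMeasure (d := 3) (L := L) (fundamentalRep (Fin 2)) (continuous_fundamentalRep (Fin 2)) β'
  have hdm : Measurable fun x => |a x - b x| := (ham.sub hbm).abs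
  have hdb : ∀ x, |(fun x => |a x - b x|) x| ≤ M + M := fun x => by
    simp only [abs_abs]; exact (abs_sub _ _).trans (add_le_add (ha x) (hb x))
  -- invariance on `|a − b|`
  have hinv := integral_transitionKernel_integral_eq_wilson (L := L) β' κ hreal t hdm ⟨M + M, hdb⟩
  rw [← hinv]
  refine integral_mono_of_nonneg (ae_of_all _ fun x => abs_nonneg _) ?_ (ae_of_all _ fun x => ?_)
  · refine Integrable.of_bound ?_ (M + M) (ae_of_all _ fun x => ?_)
    · exact (hdm.stronglyMeasurable.integral_kernel (κ := κ t)).aestronglyMeasurable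
    · rw [Real.norm_eq_abs, abs_of_nonneg (integral_nonneg fun y => abs_nonneg _)]
      have := integral_mono (μ := κ t x) (Integrable.of_bound hdm.aestronglyMeasurable (M + M)
        (ae_of_all _ fun y => by rw [Real.norm_eq_abs]; exact hdb y)) (integrable_const (M + M)) fun y => by
          have := hdb y; simp only [abs_abs] at this; exact this
      rwa [integral_const, probReal_univ, one_smul] at this
  · -- Jensen: `|∫ a − ∫ b| = |∫ (a − b)| ≤ ∫ |a − b|`
    have hai : Integrable a (κ t x) := Integrable.of_bound ham.aestronglyMeasurable M
      (ae_of_all _ fun y => by rw [Real.norm_eq_abs]; exact ha y)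
    have hbi : Integrable b (κ t x) := Integrable.of_bound hbm.aestronglyMeasurable M
      (ae_of_all _ fun y => by rw [Real.norm_eq_abs]; exact hb y)
    simp only []
    rw [← integral_sub hai hbi]
    exact abs_integral_le_integral_abs

/-! ## §3. The decay for bounded measurable densities -/

/-- ★★ **Log-Sobolev ⇒ exponential decay of entropy for every bounded measurable initial density.**  Under the generator-form
log-Sobolev inequality `ρ Ent_μ(F²) ≤ −∫ F·𝓛f dμ_{β'}` on `C³` cylinders (`ρ > 0`): for every measurable `0 ≤ g ≤ M`, every
realising kernel family and every `t ≥ 0`, `Ent_μ(κ_t g) ≤ e^{−4ρt} Ent_μ(g)`. [cite: BakryGentilLedoux2014, Thm 5.2.1] -/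
theorem entropy_transition_le_exp_of_generatorLogSobolev_of_measurable (L : ℕ) [NeZero L] (β' : ℝ)
    (κ : ℝ≥0 → Kernel (GaugeConfig 3 L (Matrix.specialUnitaryGroup (Fin 2) ℂ))
      (GaugeConfig 3 L (Matrix.specialUnitaryGroup (Fin 2) ℂ))) [∀ t, IsMarkovKernel (κ t)]
    (hreal : ∀ (t : ℝ≥0) (x : GaugeConfig 3 L (Matrix.specialUnitaryGroup (Fin 2) ℂ))
        (Ω : Type) [MeasurableSpace Ω] (P : Measure Ω) [IsProbabilityMeasure P]
        (W : ℝ≥0 → Ω → (Edge 3 L × NoiseIdx 2 → ℝ)) (hW : IsFlatBrownian W P)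
        (U : ℝ≥0 → Ω → GaugeConfig 3 L (Matrix.specialUnitaryGroup (Fin 2) ℂ)),
        (∀ ω, U 0 ω = x) →
        (latticeLangevinDynamics (fundamentalLatticeRep 2) β').IsSolution (fundamentalRep (Fin 2))
          hW.natFiltration P W U →
        κ t x = P.map (U t))
    {ρ : ℝ} (hρ : 0 < ρ)
    (hLSgen : ∀ (f : (Edge 3 L × Fin 2 × Fin 2 × Bool → ℝ) → ℝ), ContDiff ℝ 3 f →
        let coords : GaugeConfig 3 L (Matrix.specialUnitaryGroup (Fin 2) ℂ) → (Edge 3 L × Fin 2 × Fin 2 × Bool → ℝ) :=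
          fun V q => (fun z : ℂ => if q.2.2.2 then z.im else z.re)
            ((fundamentalRep (Fin 2) (V q.1) : Matrix (Fin 2) (Fin 2) ℂ) q.2.1 q.2.2.1)
        let gen : GaugeConfig 3 L (Matrix.specialUnitaryGroup (Fin 2) ℂ) → ℝ := fun V =>
          (∑ i : Edge 3 L × Fin 2 × Fin 2 × Bool, fderiv ℝ f (coords V) (Pi.single i 1) *
              (fun z : ℂ => if i.2.2.2 then z.im else z.re)
                ((latticeLangevinDynamics (fundamentalLatticeRep 2) β').drift
                  (matrixConfig (fundamentalRep (Fin 2)) V) i.1 i.2.1 i.2.2.1) +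
          1 / 2 * ∑ i : Edge 3 L × Fin 2 × Fin 2 × Bool, ∑ j : Edge 3 L × Fin 2 × Fin 2 × Bool,
            fderiv ℝ (fun z => fderiv ℝ f z (Pi.single i 1)) (coords V) (Pi.single j 1) *
              ∑ n : Edge 3 L × NoiseIdx 2,
                (if n.1 = i.1 then (fun z : ℂ => if i.2.2.2 then z.im else z.re)
                  ((latticeLangevinDynamics (fundamentalLatticeRep 2) β').noise
                    (matrixConfig (fundamentalRep (Fin 2)) V) i.1 n.2 i.2.1 i.2.2.1) else 0) *
                (if n.1 = j.1 then (fun z : ℂ => if j.2.2.2 then z.im else z.re)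
                  ((latticeLangevinDynamics (fundamentalLatticeRep 2) β').noise
                    (matrixConfig (fundamentalRep (Fin 2)) V) j.1 n.2 j.2.1 j.2.2.1) else 0))
        ρ * ((∫ V, f (coords V) ^ 2 * Real.log (f (coords V) ^ 2) ∂(wilsonMeasure (d := 3) (L := L) (fundamentalRep (Fin 2)) β')) -
            (∫ V, f (coords V) ^ 2 ∂(wilsonMeasure (d := 3) (L := L) (fundamentalRep (Fin 2)) β')) *
              Real.log (∫ V, f (coords V) ^ 2 ∂(wilsonMeasure (d := 3) (L := L) (fundamentalRep (Fin 2)) β'))) ≤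
          -∫ V, f (coords V) * gen V ∂(wilsonMeasure (d := 3) (L := L) (fundamentalRep (Fin 2)) β'))
    {g : GaugeConfig 3 L (Matrix.specialUnitaryGroup (Fin 2) ℂ) → ℝ} (hgm : Measurable g) {M : ℝ} (hg0 : ∀ x, 0 ≤ g x)
    (hgM : ∀ x, g x ≤ M) (t : ℝ≥0) :
    (∫ x, (∫ y, g y ∂(κ t x)) * Real.log (∫ y, g y ∂(κ t x)) ∂(wilsonMeasure (d := 3) (L := L) (fundamentalRep (Fin 2)) β')) -
        (∫ x, (∫ y, g y ∂(κ t x)) ∂(wilsonMeasure (d := 3) (L := L) (fundamentalRep (Fin 2)) β')) *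
          Real.log (∫ x, (∫ y, g y ∂(κ t x)) ∂(wilsonMeasure (d := 3) (L := L) (fundamentalRep (Fin 2)) β')) ≤
      Real.exp (-4 * ρ * t) *
        ((∫ x, g x * Real.log (g x) ∂(wilsonMeasure (d := 3) (L := L) (fundamentalRep (Fin 2)) β')) -
          (∫ x, g x ∂(wilsonMeasure (d := 3) (L := L) (fundamentalRep (Fin 2)) β')) *
            Real.log (∫ x, g x ∂(wilsonMeasure (d := 3) (L := L) (fundamentalRep (Fin 2)) β'))) := by
  classical
  haveI := secondCountableTopology_su2
  haveI := borelSpace_config L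
  set μ : Measure (GaugeConfig 3 L (Matrix.specialUnitaryGroup (Fin 2) ℂ)) :=
    wilsonMeasure (d := 3) (L := L) (fundamentalRep (Fin 2)) β' with hμ
  haveI : IsProbabilityMeasure μ :=
    isProbabilityMeasure_wilsonMeasure (d := 3) (L := L) (fundamentalRep (Fin 2)) (continuous_fundamentalRep (Fin 2)) β'
  have hM0 : 0 ≤ M := (hg0 (Classical.arbitrary _)).trans (hgM _)
  have hgb : ∀ x, |g x| ≤ M + 2 := fun x => by rw [abs_of_nonneg (hg0 x)]; linarith [hgM x]
  -- positive cylinders `F_n` with `∫ |F_n − g| ≤ 1/(n+1)`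
  have happ := fun n : ℕ => exists_pos_cylinder_integral_abs_sub_le L β' hgm hg0 hgM
    (show (0 : ℝ) < 1 / ((n : ℝ) + 1) by positivity)
  choose f hf hfc hrest using happ
  set Fs : ℕ → GaugeConfig 3 L (Matrix.specialUnitaryGroup (Fin 2) ℂ) → ℝ := fun n x =>
    f n (fun q => (fun z : ℂ => if q.2.2.2 then z.im else z.re)
      ((fundamentalRep (Fin 2) (x q.1) : Matrix (Fin 2) (Fin 2) ℂ) q.2.1 q.2.2.1)) with hFs
  have hFpos : ∀ n x, 0 < Fs n x := fun n => (hrest n).1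
  have hFM : ∀ n x, Fs n x ≤ M + 2 := fun n => (hrest n).2.1
  have hFL1 : ∀ n, ∫ x, |Fs n x - g x| ∂μ ≤ 1 / ((n : ℝ) + 1) := fun n => (hrest n).2.2
  have hFc : ∀ n, Continuous (Fs n) := fun n => (hf n).continuous.comp (continuous_coords (L := L))
  have hFb : ∀ n x, |Fs n x| ≤ M + 2 := fun n x => by rw [abs_of_pos (hFpos n x)]; exact hFM n x
  -- the decay for each `F_n`
  have hdec : ∀ n, (∫ x, (∫ y, Fs n y ∂(κ t x)) * Real.log (∫ y, Fs n y ∂(κ t x)) ∂μ) -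
      (∫ x, (∫ y, Fs n y ∂(κ t x)) ∂μ) * Real.log (∫ x, (∫ y, Fs n y ∂(κ t x)) ∂μ) ≤
      Real.exp (-4 * ρ * t) * ((∫ x, Fs n x * Real.log (Fs n x) ∂μ) - (∫ x, Fs n x ∂μ) * Real.log (∫ x, Fs n x ∂μ)) :=
    fun n => entropy_transition_le_exp_of_generatorLogSobolev L β' κ hreal hρ hLSgen (hf n) (hfc n) (hFpos n) t
  -- `L¹` convergence of `F_n → g` and of `κ_t F_n → κ_t g`
  have hL1 : Tendsto (fun n => ∫ x, |Fs n x - g x| ∂μ) atTop (𝓝 0) := by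
    refine squeeze_zero (fun n => integral_nonneg fun x => abs_nonneg _) hFL1 ?_
    exact tendsto_one_div_add_atTop_nhds_zero_nat
  have hKL1 : Tendsto (fun n => ∫ x, |(∫ y, Fs n y ∂(κ t x)) - ∫ y, g y ∂(κ t x)| ∂μ) atTop (𝓝 0) := by
    refine squeeze_zero (fun n => integral_nonneg fun x => abs_nonneg _) (fun n => ?_) hL1
    exact integral_abs_transition_sub_le L β' κ hreal t (hFc n).measurable hgm (hFb n) hgb
  -- measurability and bounds of `κ_t F_n`, `κ_t g`
  have hKgm : Measurable fun x => ∫ y, g y ∂(κ t x) := (hgm.stronglyMeasurable.integral_kernel (κ := κ t)).measurable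
  have hKFc : ∀ n, Continuous fun x => ∫ y, Fs n y ∂(κ t x) := fun n =>
    continuous_integral_transitionKernel L β' κ hreal t (hFc n)
  have hKFb : ∀ n x, |∫ y, Fs n y ∂(κ t x)| ≤ M + 2 := fun n x =>
    abs_integral_le_of_abs_le_of_isProbabilityMeasure (μ := κ t x) (hFb n)
  have hKgb : ∀ x, |∫ y, g y ∂(κ t x)| ≤ M + 2 := fun x =>
    abs_integral_le_of_abs_le_of_isProbabilityMeasure (μ := κ t x) hgb
  -- pass to the limit in the four integrals
  have hφ1 : Continuous fun x : ℝ => x * Real.log x := Real.continuous_mul_log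
  have T1 := EntropyFlow.tendsto_integral_comp_of_tendsto_integral_abs_sub (ν := μ) (fun n => (hFc n).aestronglyMeasurable)
    hgm.aestronglyMeasurable hFb hgb hL1 hφ1
  have T2 := EntropyFlow.tendsto_integral_comp_of_tendsto_integral_abs_sub (ν := μ) (fun n => (hFc n).aestronglyMeasurable)
    hgm.aestronglyMeasurable hFb hgb hL1 continuous_id
  have T3 := EntropyFlow.tendsto_integral_comp_of_tendsto_integral_abs_sub (ν := μ) (fun n => (hKFc n).aestronglyMeasurable)
    hKgm.aestronglyMeasurable hKFb hKgb hKL1 hφ1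
  have T4 := EntropyFlow.tendsto_integral_comp_of_tendsto_integral_abs_sub (ν := μ) (fun n => (hKFc n).aestronglyMeasurable)
    hKgm.aestronglyMeasurable hKFb hKgb hKL1 continuous_id
  simp only [id] at T2 T4
  have Tlhs : Tendsto (fun n => (∫ x, (∫ y, Fs n y ∂(κ t x)) * Real.log (∫ y, Fs n y ∂(κ t x)) ∂μ) -
      (∫ x, (∫ y, Fs n y ∂(κ t x)) ∂μ) * Real.log (∫ x, (∫ y, Fs n y ∂(κ t x)) ∂μ)) atTop
      (𝓝 ((∫ x, (∫ y, g y ∂(κ t x)) * Real.log (∫ y, g y ∂(κ t x)) ∂μ) -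
        (∫ x, (∫ y, g y ∂(κ t x)) ∂μ) * Real.log (∫ x, (∫ y, g y ∂(κ t x)) ∂μ))) :=
    T3.sub ((hφ1.tendsto _).comp T4)
  have Trhs : Tendsto (fun n => Real.exp (-4 * ρ * t) * ((∫ x, Fs n x * Real.log (Fs n x) ∂μ) -
      (∫ x, Fs n x ∂μ) * Real.log (∫ x, Fs n x ∂μ))) atTop
      (𝓝 (Real.exp (-4 * ρ * t) * ((∫ x, g x * Real.log (g x) ∂μ) - (∫ x, g x ∂μ) * Real.log (∫ x, g x ∂μ)))) :=
    (T1.sub ((hφ1.tendsto _).comp T2)).const_mul _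
  exact le_of_tendsto_of_tendsto' Tlhs Trhs hdec

end Summit.QuantumFields.YangMills.Theorems.ColdStartUniversality

end
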